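import Summits.BirchSwinnertonDyer.Rank1Residual.Additive.ChiBranchRatLowerDvdMult
import Summits.BirchSwinnertonDyer.Rank1Residual.Additive.X3RatMainConjLowerBound
import Literature.NumberTheory.EllipticCurves.Wuthrich2014.ReducibleDivisibilityCyclotomicPrimeHalf
import HarnessLib

/-!
# ENDS over the one-sided rational containment `ChiBranchRatLowerDvdMultAt` on the REDUCIBLE
# potentially-multiplicative rows (X3♯(M)): Wuthrich's printed half (Thm. 16, no image hypothesis)
# upgrades the node to `ChiBranchRatCharEqMultAt`, and `BSD(E,p)` on X3♯(M) at every `p ≡ 1 (mod 4)`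
# (cell `b2b-bsdres`, team n1011, seat n1011-p06 gen 2, OWNERS row T-N10R, phase 4, (M)-even ENDS)

HONEST FRAMING (cell `b2b-bsdres`, run/shared/lean/b2b/bsd-rank1-residual/, verbatim in every
file): the goal of the cell is to DELETE the COMBINATION-SHAPED residual classes of the
Birch–Swinnerton-Dyer formula for ALL analytic-rank `≤ 1` elliptic curves over `ℚ` — "full BSD
formula for every rank `≤ 1` curve in class `C`" assembled STRICTLY from published theorems — so
that the rank-`≤ 1` remainder becomes exactly the CONSTRUCTION-SHAPED classes, which are TYPED
(missing-input `Prop`s), NOT attempted. This is not "finishing BSD". Team n1011 (X4 ∧ `p = 3` / the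
additive block, §I items N10 / N11): research routes; prove what is provable now; no claim beyond
the stated classes; X3♯(M) stays CONSTRUCTION-SHAPED; labels / census / located gap UNCHANGED;
nothing is booked. Theorems only (no definition, no named fact minted; the Literature inputs are the
explicit binders `hWu` = Wuthrich 2014 Thm. 16 half-eigenspace reading, `hDelX`, `hDel`).

## What and why

Sibling of `ChiBranchRatLowerDvdMult.lean` (same seat), which on the IRREDUCIBLE (M) rows upgraded
the typed one-sided RATIONAL containment `ChiBranchRatLowerDvdMultAt W p` (even branch of the
multiplicative twist's one-term measure) to the rational equality `ChiBranchRatCharEqMultAt W p` by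
Kato's printed half. On the REDUCIBLE rows (`Red W p` — class X3♯(M): `E[p]` reducible, `E` potentially
multiplicative at `p`) the printed half is Wuthrich 2014 Thm. 16 ("`E` semi-stable at `p`, `E[p]`
reducible ⟹ `char_Λ X(E)` divides `(L_p(E))`", p. 397) applied to the MULTIPLICATIVE twist `V = E♭`, in
the general half-eigenspace form `Wuthrich2014.thm16_halfEigenCharIdeal_dvd_cyclotomicPrime` (its
multiplicative disjuncts; referee ruling R118.3), transported to `X(W/ℚ_∞)` by the half-tail core
keeping the series (`isTorsion_and_exists_map_eq_of_halfTail`). NO image or tower hypothesis. So: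

* §1 `exists_mem_charIdeal_map_eq_unit_mul_plusBranchMult_of_wuthrichHalf` — Wuthrich's half on
  `X(W/ℚ_∞)` as a full power-series identity, (M) twist, reducible;
* §2 `chiBranchRatCharEqMultAt_of_wuthrichHalf_of_ratLowerDvd` — on `PotMult W p ∧ Red W p`:
  `ChiBranchRatLowerDvdMultAt W p` ⟹ `ChiBranchRatCharEqMultAt W p` (`exists_span_eq_and_map_eq_C_zpow_mul`);
* §3 X3♯(M), `r_an = 0`, every `p ≡ 1 (mod 4)`: the LOWER half (EXACT: Delbourgo
  1998 Prop. 4 (M), `hDelX`, no anomalous slack) and `BSD(E,p)` ⟸ `ChiBranchRatLowerDvdMultAt W p` +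
  ONE unit coefficient + printed facts (p251406's `ClassX3M.…_of_ratCharEqMult_of_unitCoeff`), no
  image hypothesis anywhere.

X3♯(M) stays CONSTRUCTION-SHAPED; nothing booked; no label change.

References: C. Wuthrich, J. London Math. Soc. 90 (2014) Thm. 16 (p. 397), §3 (p. 390) [Wuthrich2014];
C. Skinner, E. Urban, Invent. Math. 195 (2014) Cor. 3.6.2 (p. 42), Thm. 3.6.4 (p. 43) [SkinnerUrban2014];
Mazur–Tate–Teitelbaum, Invent. Math. 84 (1986) §I.10–I.14 [MazurTateTeitelbaum1986Invent];
R. Greenberg, LNM 1716 (1999) §5 (p. 143) [GreenbergLNM1716]; D. Delbourgo, Compositio Math. 113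
(1998) Prop. 4 (p. 144), §2.2 Lemma (ii) (p. 139) [Delbourgo1998]; R. L. Miller, LMS J. Comput. Math.
14 (2011) Def. 1.1 [Miller2011LMS].
-/

noncomputable section

open scoped Classical MatrixGroups ModularForm NumberField

open CongruenceSubgroup WeierstrassCurve NumberField Literature.NumberTheory.EllipticCurves
  Literature.NumberTheory.EllipticCurves.ModularForms
  Literature.NumberTheory.EllipticCurves.Rank1Residual
  Literature.NumberTheory.EllipticCurves.Rank1Residual.Typed
  Literature.NumberTheory.GaloisRepresentations
  IsDedekindDomain

namespace Summit.BirchSwinnertonDyer.Rank1Residual.Additive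

open AdditivePotMult

/-! ### §1 Wuthrich's half on `X(E/ℚ_∞)` for the multiplicative twist — the full series -/

section WuthrichHalf

variable (W : WeierstrassCurve ℚ) [W.IsElliptic] (p : ℕ) [hp : Fact p.Prime]

/-- **Wuthrich's half of the even-branch main conjecture of the MULTIPLICATIVE twist, on `X(E/ℚ_∞)`, as a
power series identity (reducible `E[p]`).** For `W/ℚ` potentially multiplicative at `p ≡ 1 (mod 4)`
(`PotMult W p`) with `W[p]` REDUCIBLE, every globally minimal `V` with `C • V^{(p)} = W` (multiplicative
at `p`), newform `f` with `a_p(f) = ap`, cyclotomic `κ/γ`, `Λ`-dual datum `D` of `Sel_{p^∞}(W/ℚ_∞)` and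
`ϖ·Ω_V = Ω⁺_f`: `X(W/ℚ_∞)` is `Λ`-torsion and some `g ∈ char_Λ X(W/ℚ_∞)` has
`ι g = u · ϖ · L_p⁺(f, ap, ω^{(p−1)/2}, T)`, `u ∈ ℤ_pˣ`. No image hypothesis.
[cite: Wuthrich2014, Thm. 16 (p. 397), §3 (p. 390)] [cite: GreenbergLNM1716, §5 p. 143]
[cite: MazurTateTeitelbaum1986Invent, §I.10, §I.13] -/
theorem exists_mem_charIdeal_map_eq_unit_mul_plusBranchMult_of_wuthrichHalf
    (hWu : Wuthrich2014.thm16_halfEigenCharIdeal_dvd_cyclotomicPrime)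
    (hpm : AdditivePotMult.PotMult W p) (hredW : Red W p)
    (V : WeierstrassCurve ℚ) [V.IsElliptic] [V.IsGloballyMinimal]
    {κ : ZpExtension ℚ p} {γ : Field.absoluteGaloisGroup ℚ} {N : ℕ} [NeZero N]
    {f : CuspForm (Gamma0 N) 2} (hp1 : p % 4 = 1)
    (hCW : ∃ C : VariableChange ℚ, C • V.quadraticTwist (p : ℚ) = W)
    (hκ : κ.IsCyclotomic) (hγ : κ.IsTopGenerator γ) (hcv : IsCyclotomicVariable p γ)
    (hf : IsNewformOf V f) {ap : ℤ} (hap : cuspCoeff f p = ap) (D : W.SelmerDualData κ γ) (ϖ : ℚ)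
    (hϖ : (ϖ : ℝ) * V.realPeriodRat = plusPeriod f) :
    D.IsTorsion ∧ ∃ g ∈ D.charIdeal, ∃ u : ℤ_[p]ˣ,
      iwasawaToPowerSeries p g =
        PowerSeries.C (((u : ℤ_[p]) : ℚ_[p]) * (ϖ : ℚ_[p])) *
          padicLFunctionPlusBranchMult f (ap : ℚ_[p]) (p / 2) := by
  obtain ⟨C, hCW'⟩ := hCW
  have hp2 : p ≠ 2 := by rintro rfl; norm_num at hp1
  obtain ⟨heven, hps⟩ := even_half_of_mod_four_eq_one hp1
  have hpQ : (p : ℚ) ≠ 0 := Nat.cast_ne_zero.mpr hp.out.ne_zero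
  haveI : (V.quadraticTwist (p : ℚ)).IsElliptic := isElliptic_quadraticTwist V hpQ
  have hV : Mult V p := hpm.mult_of_twist_model_pStar hp2 V C (by rw [hps]; exact hCW')
  have hredV : ¬ V.HasIrreducibleModPGaloisRep p := fun hirrV ↦
    hredW ((irr_iff_of_model_twist (W := V) (p := p) hpQ ⟨C, hCW'⟩).mpr hirrV)
  -- the disjunct of the fact: split (`ap = 1`) or non-split (`ap = −1`)
  have hdisj : (IsOrdinaryAt V p ∧
        padicLFunctionPlusBranchMult f (ap : ℚ_[p]) (p / 2) =
          if Even (p / 2) then padicLFunctionBranch f ((unitRoot V p : ℤ_[p]) : ℚ_[p]) (p / 2)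
          else padicLFunctionMinusBranch f ((unitRoot V p : ℤ_[p]) : ℚ_[p]) (p / 2)) ∨
      (V.HasSplitMultiplicativeReductionAtPrime p ∧
        padicLFunctionPlusBranchMult f (ap : ℚ_[p]) (p / 2) =
          if Even (p / 2) then padicLFunctionPlusBranchMult f (1 : ℚ_[p]) (p / 2)
          else padicLFunctionMinusBranchMult f (1 : ℚ_[p]) (p / 2)) ∨
      (V.HasMultiplicativeReductionAtPrime p ∧ ¬ V.HasSplitMultiplicativeReductionAtPrime p ∧
        padicLFunctionPlusBranchMult f (ap : ℚ_[p]) (p / 2) =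
          if Even (p / 2) then padicLFunctionPlusBranchMult f (-1 : ℚ_[p]) (p / 2)
          else padicLFunctionMinusBranchMult f (-1 : ℚ_[p]) (p / 2)) := by
    by_cases hs : V.HasSplitMultiplicativeReductionAtPrime p
    · obtain ⟨h1, -⟩ := hf.cuspCoeff_eq_one_and_sq_of_split hs
      obtain rfl : ap = 1 := by exact_mod_cast (hap.symm.trans h1 : ((ap : ℤ) : ℂ) = 1)
      refine Or.inr (Or.inl ⟨hs, ?_⟩)
      rw [if_pos heven, Int.cast_one]
    · obtain ⟨h1, -⟩ := hf.cuspCoeff_eq_neg_one_and_dvd_of_nonsplit hV hs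
      obtain rfl : ap = -1 := by exact_mod_cast (hap.symm.trans h1 : ((ap : ℤ) : ℂ) = -1)
      refine Or.inr (Or.inr ⟨hV, hs, ?_⟩)
      rw [if_pos heven, Int.cast_neg, Int.cast_one]
  refine isTorsion_and_exists_map_eq_of_halfTail hCW' hp2
    (fun r hr ↦ not_sq_eq_pStar p r (by rw [hps]; exact hr)) hps hκ hγ hcv D ?_
  intro K _ _ _ F _ _ _ _ γ' h2 hθ hγ' hcyc' hγ'K hγ'F D'
  exact hWu p V K F (padicLFunctionPlusBranchMult f (ap : ℚ_[p]) (p / 2)) hp2 h2 hθ hdisj hredV hκ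
    hγ' hcyc' hγ'K hγ'F hf D' ϖ (by rw [if_pos heven]; exact hϖ)

end WuthrichHalf

/-! ### §2 The split on the reducible (M) rows: Wuthrich's half + the typed one-sided containment -/

section Split

variable {W : WeierstrassCurve ℚ} [W.IsElliptic] {p : ℕ} [hp : Fact p.Prime]

/-- **Wuthrich's printed half + the typed RATIONAL one-sided containment ⟹ the rational even-branch
main conjecture of the multiplicative twist `ChiBranchRatCharEqMultAt W p`, on the REDUCIBLE
potentially-multiplicative rows — no image hypothesis.** Two divisibilities in `Λ ⊗ ℚ_p` give a
generator `g'` with `ι g' = p^k ϖ L_p⁺` (`exists_span_eq_and_map_eq_C_zpow_mul`, SU Thm. 3.6.4 p. 43).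
[cite: Wuthrich2014, Thm. 16 (p. 397)] [cite: SkinnerUrban2014, Thm. 3.6.4, proof (p. 43)] -/
theorem chiBranchRatCharEqMultAt_of_wuthrichHalf_of_ratLowerDvd
    (hWu : Wuthrich2014.thm16_halfEigenCharIdeal_dvd_cyclotomicPrime)
    (hpm : AdditivePotMult.PotMult W p) (hredW : Red W p) (hE : ChiBranchRatLowerDvdMultAt W p) :
    ChiBranchRatCharEqMultAt W p := by
  intro V _ _ κ γ N _ f hp1 hCW hV hκ hγ hcv hf ap hap D ϖ hϖ
  obtain ⟨htor, g₁, hg₁, u, hιg₁⟩ :=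
    exists_mem_charIdeal_map_eq_unit_mul_plusBranchMult_of_wuthrichHalf W p hWu hpm hredW V hp1 hCW hκ hγ
      hcv hf hap D ϖ hϖ
  obtain ⟨g, hchar, -⟩ := exists_charIdeal_eq_span_singleton p D
  obtain ⟨G, m, n, hG, hιG⟩ := hE V hp1 hCW hV hκ hγ hcv hf ap hap D ϖ hϖ g
    (by rw [hchar]; exact Ideal.mem_span_singleton_self g)
  have hg₁' : PowerSeries.C ((u⁻¹ : ℤ_[p]ˣ) : ℤ_[p]) * g₁ ∈ Ideal.span {g} := by
    rw [← hchar]; exact Ideal.mul_mem_left _ _ hg₁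
  have hCu : iwasawaToPowerSeries p (PowerSeries.C ((u⁻¹ : ℤ_[p]ˣ) : ℤ_[p])) =
      PowerSeries.C ((((u⁻¹ : ℤ_[p]ˣ) : ℤ_[p]) : ℚ_[p])) := by
    rw [PowerSeries.map_C, PadicInt.algebraMap_apply]
  have hu0 : (((u : ℤ_[p]) : ℚ_[p])) ≠ 0 := by
    intro h0
    have h1 : (((u⁻¹ : ℤ_[p]ˣ) : ℤ_[p]) : ℚ_[p]) * (((u : ℤ_[p]) : ℚ_[p])) = 1 := by
      rw [← PadicInt.coe_mul, Units.inv_mul, PadicInt.coe_one]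
    rw [h0, mul_zero] at h1
    exact zero_ne_one h1
  have hιg₁' : iwasawaToPowerSeries p (PowerSeries.C ((u⁻¹ : ℤ_[p]ˣ) : ℤ_[p]) * g₁) =
      PowerSeries.C ((p : ℚ_[p]) ^ (0 : ℕ)) *
        (PowerSeries.C (ϖ : ℚ_[p]) * padicLFunctionPlusBranchMult f (ap : ℚ_[p]) (p / 2)) := by
    rw [pow_zero, map_one, one_mul, map_mul, hιg₁, hCu, ← mul_assoc, ← map_mul, coe_units_inv_eq_inv,
      ← mul_assoc, inv_mul_cancel₀ hu0, one_mul]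
  obtain ⟨g', k, hspan, hιg'⟩ := exists_span_eq_and_map_eq_C_zpow_mul p hg₁' hιg₁' hG hιG
  refine ⟨htor, g', k, hchar.trans hspan, ?_⟩
  rw [hιg', map_mul, mul_assoc]

end Split

/-! ### §3 X3♯(M), every `p ≡ 1 (mod 4)`: ends over `ChiBranchRatLowerDvdMultAt W p` + ONE unit coefficient -/

section Ends

variable {W : WeierstrassCurve ℚ} [W.IsElliptic] [W.IsGloballyMinimal] {p : ℕ} [hp : Fact p.Prime]

/-- **X3♯(M) (`Red W p ∧ Addv W p ∧ PotMult W p`, `p` odd), `p ≡ 1 (mod 4)`: the rational even-branch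
main conjecture of the multiplicative twist from its Skinner half**, no image hypothesis.
[cite: Wuthrich2014, Thm. 16 (p. 397)] [cite: SkinnerUrban2014, Thm. 3.6.4, proof (p. 43)] -/
theorem _root_.Summit.BirchSwinnertonDyer.Rank1Residual.AdditivePotMult.ClassX3M.chiBranchRatCharEqMultAt_of_ratLowerDvd
    (hWu : Wuthrich2014.thm16_halfEigenCharIdeal_dvd_cyclotomicPrime)
    (hX : AdditivePotMult.ClassX3M W p) (hE : ChiBranchRatLowerDvdMultAt W p) :
    ChiBranchRatCharEqMultAt W p :=
  chiBranchRatCharEqMultAt_of_wuthrichHalf_of_ratLowerDvd hWu hX.potMult hX.classX3.1 hE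

/-- **X3♯(M), `r_an = 0`, `p ≡ 1 (mod 4)`: the LOWER half `ord_p #Ш_an ≤ ord_p #Ш`
(EXACT on (M): Delbourgo 1998 Prop. 4 + §2.2 Lemma (ii), `hDelX`; no anomalous slack) ⟸ the one-sided
rational containment on the even branch of the multiplicative twist (`ChiBranchRatLowerDvdMultAt W p`)
+ ONE unit coefficient** (+ Wuthrich's half `hWu`, GZK, modularity; p251406's
`ClassX3M.missingLowerBoundAt_rankZero_of_ratCharEqMult_of_unitCoeff`). No image hypothesis.
X3♯(M) stays CONSTRUCTION-SHAPED. [cite: Wuthrich2014, Thm. 16 (p. 397)]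
[cite: Delbourgo1998, Prop. 4 (p. 144), §2.2 Lemma (ii) (p. 139)] [cite: Miller2011LMS, Def. 1.1] -/
theorem _root_.Summit.BirchSwinnertonDyer.Rank1Residual.AdditivePotMult.ClassX3M.missingLowerBoundAt_rankZero_of_ratLowerDvdMult_of_unitCoeff
    (hWu : Wuthrich2014.thm16_halfEigenCharIdeal_dvd_cyclotomicPrime)
    (hDelX : Delbourgo1998.prop4_rankZero_constantCoeff_eq_unit_mul_of_potMult)
    (hPal : Pal2012.thm32_sqrt_mul_realPeriodRat_twist_eq_of_prime_one_mod_four)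
    (hGZK : rank_eq_analyticRank_of_analyticRank_le_one) (hmod : hasEntireLFunction_rat)
    (hmodD : nonempty_modularParametrizationData)
    (hX : AdditivePotMult.ClassX3M W p) (hp4 : p % 4 = 1) (hr : W.analyticRank = 0)
    (hE : ChiBranchRatLowerDvdMultAt W p) (hcert : MultBranchUnitCoeffCert W p) :
    MissingLowerBoundAt W p :=
  hX.missingLowerBoundAt_rankZero_of_ratCharEqMult_of_unitCoeff hDelX hPal hGZK hmod hmodD hp4 hr
    (hX.chiBranchRatCharEqMultAt_of_ratLowerDvd hWu hE) hcert

/-- **X3♯(M), `r_an = 0`, `p ≡ 1 (mod 4)`: `BSD(E,p)` ⟸ the ONE-SIDED rational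
containment on the even branch of the multiplicative twist (`ChiBranchRatLowerDvdMultAt W p`, typed)
+ ONE unit coefficient, and NOTHING ELSE typed — no image hypothesis anywhere**: Wuthrich's half `hWu`
serves BOTH the upgrade (§2) and the UPPER half (additive-p1's `ClassX3M.bsdp_rankZero_of_lower` inside
p251406's `ClassX3M.bsdp_rankZero_of_ratCharEqMult_of_unitCoeff`); Delbourgo 1998 Prop. 4 (`hDelX`
exact (M), `hDel`) is the printed `T = 0` control. Nothing booked; X3♯(M) stays CONSTRUCTION-SHAPED.
[cite: Wuthrich2014, Thm. 16 (p. 397)] [cite: SkinnerUrban2014, Cor. 3.6.2 (p. 42) (shape only)]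
[cite: Delbourgo1998, Prop. 4 (p. 144)] [cite: Miller2011LMS, §1 and Def. 1.1] -/
theorem _root_.Summit.BirchSwinnertonDyer.Rank1Residual.AdditivePotMult.ClassX3M.bsdp_rankZero_of_ratLowerDvdMult_of_unitCoeff
    (hWu : Wuthrich2014.thm16_halfEigenCharIdeal_dvd_cyclotomicPrime)
    (hDelX : Delbourgo1998.prop4_rankZero_constantCoeff_eq_unit_mul_of_potMult)
    (hDel : Delbourgo1998.prop4_rankZero_pow_dvd_constantCoeff)
    (hPal : Pal2012.thm32_sqrt_mul_realPeriodRat_twist_eq_of_prime_one_mod_four)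
    (hGZK : rank_eq_analyticRank_of_analyticRank_le_one) (hmod : hasEntireLFunction_rat)
    (hmodD : nonempty_modularParametrizationData)
    (hX : AdditivePotMult.ClassX3M W p) (hp4 : p % 4 = 1) (hr : W.analyticRank = 0)
    (hE : ChiBranchRatLowerDvdMultAt W p) (hcert : MultBranchUnitCoeffCert W p) : BSDp W p :=
  hX.bsdp_rankZero_of_ratCharEqMult_of_unitCoeff hDelX hDel hPal hGZK hmod hmodD hWu hp4 hr
    (hX.chiBranchRatCharEqMultAt_of_ratLowerDvd hWu hE) hcert

end Ends

end Summit.BirchSwinnertonDyer.Rank1Residual.Additive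

end
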